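import Literature.NumberTheory.EllipticCurves.J0MulOmega
import Literature.NumberTheory.ComplexMultiplication.CMTypeRealisationGaussianSquare
import Literature.NumberTheory.ComplexMultiplication.CMTypeRealisationConjugateType
import Mathlib.RingTheory.RootsOfUnity.Complex
import HarnessLib

/-!
# The second classical structure of type `(K, Φ)` over a number field: `y² + y = x³` with `[ω]` over `ℚ(ζ₃)`

Topic `Literature/NumberTheory/ComplexMultiplication` (namespace `Literature.NumberTheory.ComplexMultiplication`,
sub-namespace `EisensteinCMCurve`); sibling of `CMTypeRealisationOverNumberField` (the Gaussian curve
`y² = x³ + x` with `[i]` over `ℚ(ζ₄)`), lane `lit-hodgefound`, Layer-B carrier `IsCMTypeRealisationOver`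
(TRIBUNAL-B row B34) and junction `HasRationalInvariantForms` (row B38).

THE INSTANCE (Silverman, *The Arithmetic of Elliptic Curves*, III.10.1 and App. C §11 Example 11.3.1;
Shimura 1998 §5.2 for "type `(K; Φ)`", §8.4 (1) «the classical case»): `k = K = ℚ(ζ₃) = ℚ(√-3)`
(`CyclotomicField 3 ℚ`, a CM field), embedded in `ℂ` by a (chosen) field embedding;
`A₀ = E′ : y² + y = x³` (`j = 0`) over `k` as an abelian variety ON THE TREE'S REAL CARRIER (the plane cubic
with the chord–tangent group law, `EllipticCurves.J0.abelianVariety`); `ι₀ : ℤ[ζ₃] = 𝓞_K → End_k(E′)`,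
`ζ₃ ↦ [ω]`, `[ω] : (x, y) ↦ (ζ₃x, y)` DEFINED OVER `k` (`EllipticCurves.J0.mulOmega`, with
`[ω] ≫ [ω] + [ω] + 𝟙 = 0`, i.e. `Φ₃([ω]) = 0`, `J0.aeval_mulOmega_cyclotomic_three`).  That
`(E′ ⊗_k ℂ, ι₀ ⊗ ℂ)` realises SOME CM type of `K` on `H¹(E′(ℂ); ℂ)` is Shimura §5.2 over `k`
(`CMSquare.exists_isCMTypeRealisationOver_iotaOfCyclotomic` of `CMTypeRealisationGaussianSquare`: a
`k`-rational `u` with `Φₘ(u) = 0` and `2 dim = φ(m)`; here `m = 3`, `2 · 1 = φ(3)`).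

* `EisensteinCMCurve.embedding : ℚ(ζ₃) →+* ℂ`, `algebraComplex` (local instance), `zeta_sq_add_zeta_add_one`
  (`ζ₃² + ζ₃ + 1 = 0`), `isCMField`, `finrank_eq_two`;
* `EisensteinCMCurve.iota₀ : 𝓞 ℚ(ζ₃) →+* End E′` (`= CMSquare.iotaOfCyclotomic`), `iota₀_toInteger_zeta`;
* **`EisensteinCMCurve.exists_isCMTypeRealisationOver_iota₀ : ∃ Φ, IsCMTypeRealisationOver Φ E′ ι₀`**;
* **`exists_isCMTypeRealisationOver_of_cmType`** — EVERY CM type of `ℚ(√-3)` is realised over `ℚ(ζ₃)` on `E′`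
  (the two types `{φ}`, `{φ̄}` by `ι₀` and `ι₀ ∘ c`; `IsCMTypeRealisationOver.exists_of_finrank_eq_two`);
* **`hasRationalInvariantForms`** — the junction predicate of Shimura's Prop. 30 holds for `E′/ℚ(ζ₃)` (every
  `k`-endomorphism acts on `H^{1,0}(E′ ⊗ ℂ) = ℂω` by an element of `ℚ(√-3) = k`; via the dimension-one
  criterion `IsCMTypeRealisationOver.hasRationalInvariantForms_of_traceField_le` of
  `ReflexFieldOfDefinitionDimOne` and `K* = k`), and `traceField_le_fieldRange_of_isCMTypeRealisationOver`
  — Prop. 30 fires;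
* corollaries in the étale form of CM type (Milne 1999 p. 54): `isOfCMType_baseChange` (`E′ ⊗_k ℂ`),
  `isOfCMType_complex` (the complex curve `y² + y = x³` with `[e^{2πi/3}]`);
* `forall_cmType_three_exists_isCMTypeRealisationOver_and_hasRationalInvariantForms` — for every CM type
  `Φ` of `ℚ(ζ₃)` a one-dimensional structure of type `(ℚ(ζ₃), Φ)` over `ℚ(ζ₃)` satisfying the junction.

Together with the Gaussian files this puts BOTH CM elliptic curves with extra automorphisms
(`j = 1728`: `ℤ[i]`; `j = 0`: `ℤ[ω]` — Silverman III.10.1, App. C §11) on the carrier over their CM fields.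
Everything is a definition with a body or a theorem; no named fact (D-0026); axioms standard.  The
`Fact (IsUnit 3)` and `Algebra ℚ(ζ₃) ℂ` instances are LOCAL.

## References

* [SilvermanAEC2009] J. H. Silverman, *The Arithmetic of Elliptic Curves*, 2nd ed. (2009), III.10.1
  (`Aut(E) ≅ μ₆` for `j = 0`), App. C §11 Example 11.3.1 (`j = 0`: complex multiplication by `ℤ[ω]`),
  III.5 Cor. 5.6.
* [Shimura1998] G. Shimura, *Abelian Varieties with Complex Multiplication and Modular Functions* (1998),
  §5.2 (type `(F; {φᵢ})`), §8.4 Example (1), §8.5 Prop. 30, §19.7 (structures of type `(K, Φ)` over `k`).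
* [Milne1999] J. S. Milne, *Lefschetz motives and the Tate conjecture*, Compositio Math. 117 (1999), §2 p. 54.
* [Washington1997] L. C. Washington, *Introduction to Cyclotomic Fields*, 2nd ed. (1997), Thm. 2.5.
-/

noncomputable section

open Polynomial NumberField CategoryTheory IsCyclotomicExtension
open Literature.AlgebraicGeometry.Motives (AbelianVariety CMType)
open Literature.AlgebraicGeometry.ComplexMultiplication (IsCMTypeRealisation complexAction
  CyclotomicPair.exists_isCMTypeRealisation)
open Literature.NumberTheory.EllipticCurves

namespace Literature.NumberTheory.ComplexMultiplication

namespace EisensteinCMCurve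

/-! ### The field `k = K = ℚ(ζ₃) = ℚ(√-3)` and its embedding into `ℂ` -/

/-- `ℚ(ζ₃) = ℚ(√-3)` as Mathlib's `CyclotomicField 3 ℚ`. -/
local notation "K₃" => CyclotomicField 3 ℚ

/-- `ℚ(ζ₃)/ℚ` is the cyclotomic extension for `S = {3}` (Mathlib's instance, registered LOCALLY for the
literal `3`). [folklore] -/
private theorem isCyclotomicExtension_three : IsCyclotomicExtension {3} ℚ K₃ :=
  CyclotomicField.isCyclotomicExtension 3 ℚ

attribute [local instance] isCyclotomicExtension_three

/-- A field embedding `ℚ(ζ₃) → ℂ` (any of the two; Mathlib's `IsAlgClosed.lift`), through which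
`k = ℚ(ζ₃)` is regarded as a subfield of `ℂ` (Shimura 19.7: "`k ⊆ ℂ`"). [cite: Shimura1998, §19.7] -/
def embedding : K₃ →+* ℂ := (IsAlgClosed.lift : K₃ →ₐ[ℚ] ℂ).toRingHom

/-- `ℂ` as a `ℚ(ζ₃)`-algebra through `embedding` (a LOCAL instance). [folklore] -/
abbrev algebraComplex : Algebra K₃ ℂ := (embedding).toAlgebra

attribute [local instance] algebraComplex

/-- `3` is a unit of `ℚ(ζ₃)` (characteristic zero), so that `y² + y = x³` is elliptic (`Δ = -27`);
a LOCAL instance. [folklore] -/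
private theorem fact_isUnit_three : Fact (IsUnit (3 : K₃)) := ⟨isUnit_iff_ne_zero.mpr three_ne_zero⟩

attribute [local instance] fact_isUnit_three

/-- `E′ : y² + y = x³` over `ℚ(ζ₃)` (`EllipticCurves.J0.abelianVariety`). -/
local notation "E′" => J0.abelianVariety (CyclotomicField 3 ℚ)

/-- The chosen primitive cube root of unity `ζ₃ ∈ ℚ(ζ₃)`. [cite: SilvermanAEC2009, III.10.1] -/
theorem isPrimitiveRoot_zeta : IsPrimitiveRoot (zeta 3 ℚ K₃) 3 := zeta_spec 3 ℚ K₃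

/-- **`ζ₃² + ζ₃ + 1 = 0`** (`ζ₃` is a root of `Φ₃ = X² + X + 1`). [cite: SilvermanAEC2009, III.10.1] -/
theorem zeta_sq_add_zeta_add_one : (zeta 3 ℚ K₃) ^ 2 + zeta 3 ℚ K₃ + 1 = 0 := by
  have h := isPrimitiveRoot_zeta.isRoot_cyclotomic (by norm_num)
  rw [cyclotomic_three, IsRoot.def] at h
  simpa [eval_add, eval_pow, eval_X, eval_one] using h

/-- `ℚ(ζ₃)` is a CM field (Mathlib: a cyclotomic field `ℚ(ζₙ)`, `n > 2`, is CM). [folklore] -/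
instance isCMField : IsCMField K₃ := IsCyclotomicExtension.Rat.isCMField K₃ (S := ({3} : Set ℕ)) ⟨3, rfl, by norm_num⟩

/-- `[ℚ(ζ₃) : ℚ] = φ(3) = 2`. [cite: Washington1997, Thm. 2.5] -/
theorem finrank_eq_two : Module.finrank ℚ K₃ = 2 := by
  rw [IsCyclotomicExtension.finrank K₃ (cyclotomic.irreducible_rat (n := 3) (by norm_num))]
  decide

/-! ### `ι₀ : 𝓞_K = ℤ[ζ₃] → End_k(E′)`, `ζ₃ ↦ [ω]` -/

/-- `Φ₃([ω]) = 0` in `End_k(E′)` for `E′ : y² + y = x³` over `k = ℚ(ζ₃)` and `[ω] = [ζ₃] : (x, y) ↦ (ζ₃x, y)`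
(`[ω]² + [ω] + 1 = 0`, `EllipticCurves.J0.aeval_mulOmega_cyclotomic_three`).
[cite: SilvermanAEC2009, App. C §11 Example 11.3.1] -/
theorem aeval_mulOmega_cyclotomic_three :
    aeval (R := ℤ) (show End E′ from J0.mulOmega zeta_sq_add_zeta_add_one) (cyclotomic 3 ℤ) = 0 :=
  J0.aeval_mulOmega_cyclotomic_three zeta_sq_add_zeta_add_one

/-- **`ι₀ : 𝓞_K = ℤ[ζ₃] → End_k(E′)`, `ζ₃ ↦ [ω]`** — the `ℤ[ω]`-structure of `E′ : y² + y = x³` over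
`k = ℚ(ζ₃)` (Mathlib's `PowerBasis.lift` along the integral power basis of `ζ₃`, legitimate because
`Φ₃([ω]) = 0`; the tree's generic `CMSquare.iotaOfCyclotomic`). [cite: SilvermanAEC2009, App. C §11 Example 11.3.1]
[cite: Shimura1998, §5.1 (p. 35) and §19.7] -/
def iota₀ : 𝓞 K₃ →+* End E′ :=
  CMSquare.iotaOfCyclotomic isPrimitiveRoot_zeta (J0.abelianVariety K₃) aeval_mulOmega_cyclotomic_three

/-- `ι₀(ζ₃) = [ω]`. [cite: SilvermanAEC2009, App. C §11 Example 11.3.1] -/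
theorem iota₀_toInteger_zeta :
    iota₀ isPrimitiveRoot_zeta.toInteger = J0.mulOmega zeta_sq_add_zeta_add_one :=
  CMSquare.iotaOfCyclotomic_toInteger isPrimitiveRoot_zeta (J0.abelianVariety K₃) aeval_mulOmega_cyclotomic_three

/-! ### The realisation over `ℚ(ζ₃)` -/

/-- `2 · dim E′ = φ(3)` (`dim E′ = 1`, `φ(3) = 2 = [ℚ(ζ₃) : ℚ]`). [cite: Shimura1998, §5.2] -/
theorem two_mul_dim : 2 * (J0.abelianVariety K₃).dim = Nat.totient 3 := by
  rw [J0.dim_abelianVariety]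
  decide

/-- **`(E′, ι₀)` over `k = ℚ(ζ₃)` is a structure of type `(ℚ(ζ₃), Φ)` for some CM type `Φ`**:
`(E′ ⊗_k ℂ, ι₀ ⊗ ℂ)` realises a CM type of `K = ℚ(ζ₃)` read on `H¹(E′(ℂ); ℂ)` — Shimura §5.2 over `k` for the
`k`-rational `[ω]` with `Φ₃([ω]) = 0`, `2 dim = φ(3)` (`CMSquare.exists_isCMTypeRealisationOver_iotaOfCyclotomic`).
Which of the two CM types of `ℚ(√-3)` occurs depends on the embedding `k → ℂ` and is not asserted.
[cite: Shimura1998, §5.2 and §19.7] [cite: SilvermanAEC2009, App. C §11 Example 11.3.1] -/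
theorem exists_isCMTypeRealisationOver_iota₀ :
    ∃ Φ : CMType K₃, IsCMTypeRealisationOver Φ (J0.abelianVariety K₃) iota₀ :=
  CMSquare.exists_isCMTypeRealisationOver_iotaOfCyclotomic isPrimitiveRoot_zeta (J0.abelianVariety K₃)
    aeval_mulOmega_cyclotomic_three two_mul_dim

/-- **Every CM type of `ℚ(ζ₃)` is realised over `k = ℚ(ζ₃)` on `E′ : y² + y = x³`**: for each of the two CM
types `Φ = {φ}`, `{φ̄}` of `ℚ(√-3)` there is `ι : ℤ[ζ₃] → End_k(E′)` (`ζ₃ ↦ [ω]`, resp. `ζ₃ ↦ [ω²] = [ω̄]`) with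
`IsCMTypeRealisationOver Φ E′ ι` — the structure `(E′, ι₀)` and its twist by complex conjugation
(`IsCMTypeRealisationOver.exists_of_finrank_eq_two`). [cite: Shimura1998, §8.4 Example (1) and §19.7]
[cite: SilvermanAEC2009, App. C §11 Example 11.3.1] -/
theorem exists_isCMTypeRealisationOver_of_cmType (Φ : CMType K₃) :
    ∃ ι : 𝓞 K₃ →+* End E′, IsCMTypeRealisationOver Φ (J0.abelianVariety K₃) ι := by
  obtain ⟨Φ₀, hΦ₀⟩ := exists_isCMTypeRealisationOver_iota₀
  exact hΦ₀.exists_of_finrank_eq_two finrank_eq_two Φ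

/-! ### The junction `HasRationalInvariantForms E′` and Proposition 30 -/

/-- Two `ℚ`-embeddings of a normal extension into any field have the same image (copy of the tree's
`SorensenPatching.fieldRange_eq_fieldRange_of_normal`, kept local to spare the import). [folklore] -/
private theorem fieldRange_eq_fieldRange_of_normal' {F L M : Type*} [Field F] [Field L] [Field M]
    [Algebra F L] [Algebra F M] [Normal F L] (f g : L →ₐ[F] M) : f.fieldRange = g.fieldRange := by
  have key : ∀ f g : L →ₐ[F] M, g.fieldRange ≤ f.fieldRange := by
    intro f g
    haveI : Normal F f.fieldRange := Normal.of_algEquiv f.equivFieldRange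
    have h := AlgHom.fieldRange_of_normal (g.comp f.equivFieldRange.symm.toAlgHom)
    intro z hz
    obtain ⟨x, rfl⟩ := AlgHom.mem_fieldRange.1 hz
    rw [← h]
    exact ⟨f.equivFieldRange x, by simp⟩
  exact le_antisymm (key g f) (key f g)

/-- **`K* ⊆ k` for `k = K = ℚ(ζ₃)`**: for EVERY CM type `Φ = {φ}` of `ℚ(ζ₃)`, the complex reflex field
`ℚ(tr_Φ) = φ(ℚ(ζ₃))` lies in (indeed equals) the image of `k = ℚ(ζ₃)` under the chosen embedding (`ℚ(ζ₃)/ℚ`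
is normal, so all its embeddings have the same image `ℚ(√-3) ⊂ ℂ`). [cite: Shimura1998, §8.4 Example (1)] -/
theorem traceField_le_fieldRange_embedding (Φ : CMType K₃) :
    (traceField Φ).toSubfield ≤ embedding.fieldRange := by
  haveI : IsGalois ℚ K₃ := IsCyclotomicExtension.isGalois {3} ℚ K₃
  obtain ⟨φ, rfl⟩ := CMTypeCount.exists_eq_single finrank_eq_two Φ
  rw [CMTypeCount.traceField_single finrank_eq_two φ,
    fieldRange_eq_fieldRange_of_normal' φ.toRatAlgHom embedding.toRatAlgHom]
  intro z hz
  obtain ⟨x, rfl⟩ := AlgHom.mem_fieldRange.1 hz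
  exact RingHom.mem_fieldRange.2 ⟨x, rfl⟩

/-- **The junction holds for the Eisenstein curve**: for `E′ : y² + y = x³` over `k = ℚ(ζ₃) ⊂ ℂ`,
`HasRationalInvariantForms E′` — every `k`-endomorphism acts on `H^{1,0}(E′ ⊗ ℂ) = ℂω` by an element of
`ℚ(√-3) = k` ("`[ω]^*ω = ζ₃ω`"), by `IsCMTypeRealisationOver.hasRationalInvariantForms_of_traceField_le`
(the dimension-one criterion of `ReflexFieldOfDefinitionDimOne`) on the structure `(E′, ι₀)`.
[cite: Shimura1998, §2.8 and §8.5 Prop. 30] [cite: SilvermanAEC2009, III.5 Cor. 5.6 and App. C §11 Example 11.3.1] -/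
theorem hasRationalInvariantForms : HasRationalInvariantForms (J0.abelianVariety K₃) := by
  obtain ⟨Φ, hΦ⟩ := exists_isCMTypeRealisationOver_iota₀
  exact hΦ.hasRationalInvariantForms_of_traceField_le finrank_eq_two (traceField_le_fieldRange_embedding Φ)

/-- **Proposition 30 FIRES on the Eisenstein curve**: for every CM type `Φ` of `ℚ(ζ₃)` and every
`ι : ℤ[ζ₃] → End_k(E′)` making `(E′, ι)` a structure of type `(ℚ(ζ₃), Φ)` over `k = ℚ(ζ₃)`, Shimura's
`K* = ℚ(tr_Φ) ⊆ k` is an instance of the typed Prop. 30 (`traceField_le_fieldRange_of_isCMTypeRealisationOver`)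
with its junction hypothesis DISCHARGED by `hasRationalInvariantForms`. [cite: Shimura1998, §8.5 Prop. 30 (p. 88)] -/
theorem traceField_le_fieldRange_of_isCMTypeRealisationOver {Φ : CMType K₃} {ι : 𝓞 K₃ →+* End E′}
    (h : IsCMTypeRealisationOver Φ (J0.abelianVariety K₃) ι) :
    (traceField Φ).toSubfield ≤ embedding.fieldRange :=
  ComplexMultiplication.traceField_le_fieldRange_of_isCMTypeRealisationOver h hasRationalInvariantForms

/-! ### Corollaries: `E′ ⊗ ℂ` and the complex curve `y² + y = x³` are of CM type (étale form) -/

open Literature.AlgebraicGeometry.Milne1999 (IsOfCMType)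

/-- **`E′ ⊗_k ℂ` is of CM type** (Milne 1999 p. 54, étale form `Milne1999.IsOfCMType`: `End⁰` contains a
commutative reduced `ℚ`-subalgebra of degree `2 dim`, here `ℚ(ι₀(𝓞_K)) ≅ ℚ(√-3)`), by the tree theorem
`IsCMTypeRealisation.isOfCMType`. [cite: Milne1999, §2 p. 54] [cite: SilvermanAEC2009, App. C §11 Example 11.3.1] -/
theorem isOfCMType_baseChange : IsOfCMType ((J0.abelianVariety K₃).baseChange ℂ) := by
  obtain ⟨Φ, θ, h⟩ := exists_isCMTypeRealisationOver_iota₀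
  exact h.isOfCMType

/-- `3` is a unit of `ℂ`; a LOCAL instance (so that `y² + y = x³` over `ℂ` is elliptic). [folklore] -/
private theorem fact_isUnit_three_complex : Fact (IsUnit (3 : ℂ)) := ⟨isUnit_iff_ne_zero.mpr three_ne_zero⟩

attribute [local instance] fact_isUnit_three_complex

/-- `ω = e^{2πi/3} ∈ ℂ` satisfies `ω² + ω + 1 = 0` (a primitive cube root of unity, Mathlib
`Complex.isPrimitiveRoot_exp`). [folklore] -/
private theorem exp_sq_add_exp_add_one :
    Complex.exp (2 * Real.pi * Complex.I / 3) ^ 2 + Complex.exp (2 * Real.pi * Complex.I / 3) + 1 = 0 := by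
  have h := (Complex.isPrimitiveRoot_exp 3 (by norm_num)).isRoot_cyclotomic (by norm_num)
  rw [cyclotomic_three, IsRoot.def] at h
  simpa [eval_add, eval_pow, eval_X, eval_one] using h

/-- `Φ₃([ω]) = 0` in `End(E′_ℂ)` for the COMPLEX curve `E′_ℂ : y² + y = x³` and `[ω] = [e^{2πi/3}]`.
[cite: SilvermanAEC2009, App. C §11 Example 11.3.1] -/
theorem aeval_mulOmega_complex_cyclotomic_three :
    aeval (R := ℤ) (show End (J0.abelianVariety ℂ) from J0.mulOmega exp_sq_add_exp_add_one)
      (cyclotomic 3 ℤ) = 0 :=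
  J0.aeval_mulOmega_cyclotomic_three exp_sq_add_exp_add_one

/-- **The complex elliptic curve `y² + y = x³` is of CM type** (étale form): `([ω] : E′_ℂ ⟶ E′_ℂ)` with
`Φ₃([ω]) = 0`, `2 dim E′_ℂ = φ(3)`, realises a CM type of `ℚ(ζ₃)` on `H¹` (`CyclotomicPair.exists_isCMTypeRealisation`),
hence `End⁰(E′_ℂ) ⊇ ℚ(√-3)` of degree `2 = 2 dim`. [cite: SilvermanAEC2009, App. C §11 Example 11.3.1] [cite: Milne1999, §2 p. 54] -/
theorem isOfCMType_complex : IsOfCMType (J0.abelianVariety ℂ) := by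
  obtain ⟨ι, φ, Φ, -, hreal, -⟩ := CyclotomicPair.exists_isCMTypeRealisation (K := K₃)
    (A := J0.abelianVariety ℂ) isPrimitiveRoot_zeta aeval_mulOmega_complex_cyclotomic_three
    (by rw [J0.dim_abelianVariety]; decide)
  exact hreal.isOfCMType

end EisensteinCMCurve

/-- **For EVERY CM type `Φ` of `ℚ(ζ₃)`: a structure of type `(ℚ(ζ₃), Φ)` over the number field `ℚ(ζ₃)` on an
elliptic curve satisfying the junction of Shimura's Prop. 30** (`HasRationalInvariantForms`): `k = K = ℚ(ζ₃)`,
`A₀ = E′ : y² + y = x³`, `ι = ι₀` (`ζ₃ ↦ [ω]`) or `ι₀ ∘ c` — the `ℚ(√-3)` companion of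
`forall_cmType_exists_isCMTypeRealisationOver_and_hasRationalInvariantForms` (`ℚ(i)`, `y² = x³ + x`).
[cite: SilvermanAEC2009, III.10.1 and App. C §11 Example 11.3.1] [cite: Shimura1998, §8.4 Example (1), §8.5 Prop. 30, §19.7] -/
theorem forall_cmType_three_exists_isCMTypeRealisationOver_and_hasRationalInvariantForms :
    ∀ Φ : CMType (CyclotomicField 3 ℚ),
      ∃ (_ : Algebra (CyclotomicField 3 ℚ) ℂ) (A₀ : AbelianVariety (CyclotomicField 3 ℚ))
        (ι : 𝓞 (CyclotomicField 3 ℚ) →+* End A₀),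
        A₀.dim = 1 ∧ IsCMTypeRealisationOver Φ A₀ ι ∧ HasRationalInvariantForms A₀ := by
  intro Φ
  letI : Algebra (CyclotomicField 3 ℚ) ℂ := EisensteinCMCurve.algebraComplex
  letI : Fact (IsUnit (3 : CyclotomicField 3 ℚ)) := ⟨isUnit_iff_ne_zero.mpr three_ne_zero⟩
  haveI : IsCyclotomicExtension {3} ℚ (CyclotomicField 3 ℚ) := CyclotomicField.isCyclotomicExtension 3 ℚ
  obtain ⟨ι, hι⟩ := EisensteinCMCurve.exists_isCMTypeRealisationOver_of_cmType Φ
  exact ⟨EisensteinCMCurve.algebraComplex, J0.abelianVariety (CyclotomicField 3 ℚ), ι,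
    J0.dim_abelianVariety _, hι, EisensteinCMCurve.hasRationalInvariantForms⟩

/-- **A one-dimensional complex abelian variety of CM type by `ℚ(√-3)`** on the tree's carrier: the complex
curve `y² + y = x³` with `[e^{2πi/3}]` (companion of `exists_isOfCMType_dim_eq_one`, the Gaussian curve).
[cite: SilvermanAEC2009, App. C §11 Example 11.3.1] [cite: Milne1999, §2 p. 54] -/
theorem exists_isOfCMType_dim_eq_one' :
    ∃ A : AbelianVariety ℂ, A.dim = 1 ∧ Literature.AlgebraicGeometry.Milne1999.IsOfCMType A ∧
      ∃ u : A ⟶ A, u ≠ 𝟙 A ∧ (u ≫ u) ≫ u = 𝟙 A :=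
  letI : Fact (IsUnit (3 : ℂ)) := ⟨isUnit_iff_ne_zero.mpr three_ne_zero⟩
  ⟨J0.abelianVariety ℂ, J0.dim_abelianVariety ℂ, EisensteinCMCurve.isOfCMType_complex,
    J0.mulOmega EisensteinCMCurve.exp_sq_add_exp_add_one,
    J0.mulOmega_ne_id _, J0.mulOmega_comp_mulOmega_comp_mulOmega _⟩

end Literature.NumberTheory.ComplexMultiplication

end
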